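import Mathlib.LinearAlgebra.Semisimple
import Literature.LinearAlgebra.Matrix.RegularAdRangeSupCommutant   -- ★ `Module.End.IsSemisimple.isCompl_ker_range`, `aeval_mulLeft_apply`∕`aeval_mulRight_apply` (the REGULAR-charpoly road «N6-ns» chart-A; ED. 2 cites it)
import Mathlib.LinearAlgebra.Matrix.Charpoly.Minpoly
import Mathlib.LinearAlgebra.Matrix.NonsingularInverse
import Mathlib.LinearAlgebra.FiniteDimensional.Lemmas
import HarnessLib

/-!
# K2 · E3 ∕ U12-d, road (S-d) file 1 — for a SEMISIMPLE matrix `S`, `M_N(K) = Z(S) ⊕ [S, M_N(K)]`: the kernel and the image of `Ad S − 1` are complementary,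
# and the splitting descends to the fixed space of any involution commuting with `Ad S` (the Lie algebra `𝔲` of a unitary group containing `S`)

HCML Track B «K2-LIT», cell `pub/hodgecm-mathlib`, crux H413 = `stmt-HodgeConjecture-24833` (`--supports … --as helper`), seat `hodgecm-mathlib-K2E3-p12` (g0),
socket #12 `sig_K2E3NormalizedCharBddNearSemisimple`, sub-socket (S-d) «conjugates of the Cayley slice through a semisimple point fill a neighbourhood»
(memo `K2/K2E3-p12/g0/MEMO-U12d-Sd-road.v1.K2E3-p12-g0.md`, file 1 of 3).  Harish-Chandra's submersion `(x, m) ↦ x γ m x⁻¹` [HarishChandra1999 §18 p. 79: «Since γ is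
semisimple, `𝔤 = 𝔪 + 𝔮` where the sum is direct … the mapping `(x, m) ↦ xγmx⁻¹` of `G × U_M` into `U` is submersive»] rests on exactly one piece of linear algebra:
for semisimple `γ`, `𝔤 = ker(Ad γ − 1) ⊕ im(Ad γ − 1)`.  THIS FILE proves it, Mathlib-only:
* §1 (ED. 2, DEDUP) the generic splitting `V = ker f ⊕ range f` for a semisimple `f` is ★ `Module.End.IsSemisimple.isCompl_ker_range` of
  `Literature/LinearAlgebra/Matrix/RegularAdRangeSupCommutant` (road «N6-ns», chart-A, where §2 below is proved under the STRONGER hypothesis «`charpoly` separable»);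
  ED. 1 of this file re-proved it — ED. 2 cites it and keeps only what is new: the SEMISIMPLE (not necessarily regular) case of §2 and §§3–4.
* §2 `aeval_mulLeft`∕`aeval_mulRight` (bundled forms of ★ `aeval_mulLeft_apply`∕`aeval_mulRight_apply`), `isSemisimple_mulLeft`∕`isSemisimple_mulRight` — left∕right multiplication by a semisimple matrix is a semisimple operator on
  `M_n(K)` (same minimal polynomial; Mathlib `isSemisimple_of_squarefree_aeval_eq_zero`, `IsSemisimple.minpoly_squarefree`, `Matrix.minpoly_toLin'`);
  `isSemisimple_mulLeft_sub_mulRight` — `T_S := L_S − R_S : X ↦ SX − XS` is semisimple (commuting semisimple operators, Mathlib `IsSemisimple.sub_of_commute`,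
  perfect field); **`isCompl_centralizer_commutators`**: `M_n(K) = ker T_S ⊕ range T_S = Z(S) ⊕ [S, M_n(K)]`.
* §3 `ker_adSubOne_eq`, `range_adSubOne_eq`, **`isCompl_ker_range_adSubOne`** — the same for `A_S := Ad S − 1 : X ↦ SXS⁻¹ − X` (`S` invertible): `A_S = T_S ∘ R_{S⁻¹}`.
* §4 **`exists_fixed_decomposition`** — DESCENT TO A FIXED SPACE: if `V = ker A ⊕ range A`, `τ` is an additive involution commuting with `A` and with the scalar `½`,
  then every `τ`-fixed `x` is `k + A m` with `k, m` BOTH `τ`-fixed and `A k = 0` (uniqueness of the decomposition + averaging `m ↦ ½(m + τm)`).  For `S` in a unitary group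
  `U(σ, J)` and `τ X = −J⁻¹(σX)ᵀJ` (so `Fix τ = 𝔲`, and `τ ∘ Ad S = Ad S ∘ τ`) this is `𝔲 = 𝔪_S ⊕ (Ad S − 1)𝔲` — the surjectivity of the differential in (S-d); the
  instantiation is file 2's (field model of `U_N(H)(L⁺_v)`).
THEOREMS ONLY (no `def`, no instance, no notation, no `sorry`, axioms ⊆ the trio).  HONEST LABEL: pure linear algebra; HC_CM is proved only modulo the 7 printed
citations (2 remaining named inputs: hLiu418 = stmt-HodgeConjecture-24832, h413 = stmt-HodgeConjecture-24833) until rung 0 closes.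

## References
* [HarishChandra1999AdmissibleDistributions] Harish-Chandra (DeBacker–Sally), *Admissible Invariant Distributions on Reductive p-adic Groups* (1999), §18 p. 79.
* [Borel1991] A. Borel, *Linear Algebraic Groups*, 2nd ed. (1991), §4.4 (semisimple endomorphisms: `V = ker ⊕ im`), §9.1 (`Ad s` semisimple for semisimple `s`).
-/

set_option autoImplicit false
set_option linter.dupNamespace false

open Polynomial

namespace Summit.HodgeConjecture.HodgeConjecture.Cruxes.H413.K2E3AdSemisimpleKerRangeCompl

/-! ## §1 (ED. 2) `V = ker f ⊕ range f` for semisimple `f` is ★ `Module.End.IsSemisimple.isCompl_ker_range`; the ED. 1 copies are kept (append-only) as deprecated aliases -/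

section Generic

variable {K V : Type*} [Field K] [AddCommGroup V] [Module K V]

/-- The kernel of `f` is `f`-invariant (ED. 1 helper; kept for append-only). [folklore] -/
theorem ker_mem_invtSubmodule (f : Module.End K V) : LinearMap.ker f ∈ f.invtSubmodule := by
  rw [Module.End.mem_invtSubmodule]
  intro x hx
  rw [Submodule.mem_comap, LinearMap.mem_ker, LinearMap.mem_ker.1 hx, map_zero]

/-- DEPRECATED ALIAS (ED. 2): this is ★ `Module.End.IsSemisimple.isCompl_ker_range` (`Literature/LinearAlgebra/Matrix/RegularAdRangeSupCommutant`), which ED. 1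
re-proved; kept only because Theorems files are append-only — cite the ★ lemma. [cite: Borel1991, §4.4] -/
@[deprecated Module.End.IsSemisimple.isCompl_ker_range (since := "2026-09-03")]
theorem isCompl_ker_range_of_isSemisimple [FiniteDimensional K V] {f : Module.End K V} (hf : f.IsSemisimple) :
    IsCompl (LinearMap.ker f) (LinearMap.range f) :=
  hf.isCompl_ker_range

end Generic


/-! ## §2 Left and right multiplication by a semisimple matrix; `T_S = L_S − R_S` -/

section MatrixOps

variable {K : Type*} [Field K] {n : Type*} [Fintype n] [DecidableEq n]

/-- `p(L_S) = L_{p(S)}` (left multiplication is an algebra map `M_n(K) → End M_n(K)`, Mathlib `Algebra.lmul`). [folklore] -/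
theorem aeval_mulLeft (S : Matrix n n K) (p : K[X]) :
    aeval (LinearMap.mulLeft K S) p = LinearMap.mulLeft K (aeval S p) :=
  LinearMap.ext fun X => by rw [Literature.LinearAlgebra.Matrix.aeval_mulLeft_apply, LinearMap.mulLeft_apply]

/-- `(R_S)^k = R_{S^k}` (ED. 1 helper = Mathlib `LinearMap.pow_mulRight` up to orientation; kept for append-only). [folklore] -/
theorem mulRight_pow (S : Matrix n n K) (k : ℕ) : LinearMap.mulRight K S ^ k = LinearMap.mulRight K (S ^ k) := by
  induction k with
  | zero =>
      refine LinearMap.ext fun X => ?_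
      rw [pow_zero, pow_zero, Module.End.one_apply, LinearMap.mulRight_apply, mul_one]
  | succ k ih =>
      rw [pow_succ, ih]
      refine LinearMap.ext fun X => ?_
      rw [Module.End.mul_apply, LinearMap.mulRight_apply, LinearMap.mulRight_apply, LinearMap.mulRight_apply, mul_assoc, ← pow_succ']

/-- `p(R_S) = R_{p(S)}` (bundled form of ★ `aeval_mulRight_apply`). [folklore] -/
theorem aeval_mulRight (S : Matrix n n K) (p : K[X]) :
    aeval (LinearMap.mulRight K S) p = LinearMap.mulRight K (aeval S p) :=
  LinearMap.ext fun X => by rw [Literature.LinearAlgebra.Matrix.aeval_mulRight_apply, LinearMap.mulRight_apply]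

/-- **Left multiplication by a semisimple matrix is a semisimple operator on `M_n(K)`** (its minimal polynomial divides that of `S`, which is square-free).
[cite: Borel1991, §4.4] -/
theorem isSemisimple_mulLeft (S : Matrix n n K) (hS : Module.End.IsSemisimple (Matrix.toLin' S)) :
    Module.End.IsSemisimple (LinearMap.mulLeft K S) := by
  have hsq : Squarefree (minpoly K S) := by
    rw [← Matrix.minpoly_toLin']
    exact hS.minpoly_squarefree
  refine Module.End.isSemisimple_of_squarefree_aeval_eq_zero hsq ?_
  rw [aeval_mulLeft, minpoly.aeval, LinearMap.mulLeft_zero_eq_zero]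

/-- **Right multiplication by a semisimple matrix is a semisimple operator on `M_n(K)`.** [cite: Borel1991, §4.4] -/
theorem isSemisimple_mulRight (S : Matrix n n K) (hS : Module.End.IsSemisimple (Matrix.toLin' S)) :
    Module.End.IsSemisimple (LinearMap.mulRight K S) := by
  have hsq : Squarefree (minpoly K S) := by
    rw [← Matrix.minpoly_toLin']
    exact hS.minpoly_squarefree
  refine Module.End.isSemisimple_of_squarefree_aeval_eq_zero hsq ?_
  rw [aeval_mulRight, minpoly.aeval, LinearMap.mulRight_zero_eq_zero]

/-- **`T_S = L_S − R_S : X ↦ SX − XS` is semisimple for semisimple `S`** (difference of commuting semisimple operators over a perfect field, Mathlib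
`IsSemisimple.sub_of_commute`) — i.e. `ad S` is semisimple. [cite: Borel1991, §4.4] -/
theorem isSemisimple_mulLeft_sub_mulRight [PerfectField K] (S : Matrix n n K) (hS : Module.End.IsSemisimple (Matrix.toLin' S)) :
    Module.End.IsSemisimple (LinearMap.mulLeft K S - LinearMap.mulRight K S) :=
  Module.End.IsSemisimple.sub_of_commute (LinearMap.commute_mulLeft_right S S) (isSemisimple_mulLeft S hS) (isSemisimple_mulRight S hS)

/-- **`M_n(K) = Z(S) ⊕ [S, M_n(K)]` for a semisimple matrix `S`**: the centraliser `{X | SX = XS} = ker T_S` and the commutator space `{SX − XS} = range T_S` are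
complementary. [cite: Borel1991, §4.4, §9.1] [cite: HarishChandra1999AdmissibleDistributions, §18 p. 79] -/
theorem isCompl_centralizer_commutators [PerfectField K] (S : Matrix n n K) (hS : Module.End.IsSemisimple (Matrix.toLin' S)) :
    IsCompl (LinearMap.ker (LinearMap.mulLeft K S - LinearMap.mulRight K S)) (LinearMap.range (LinearMap.mulLeft K S - LinearMap.mulRight K S)) :=
  (isSemisimple_mulLeft_sub_mulRight S hS).isCompl_ker_range

/-- Membership in `ker T_S` is commuting with `S`. [folklore] -/
theorem mem_ker_mulLeft_sub_mulRight_iff (S X : Matrix n n K) :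
    X ∈ LinearMap.ker (LinearMap.mulLeft K S - LinearMap.mulRight K S) ↔ S * X = X * S := by
  rw [LinearMap.mem_ker, LinearMap.sub_apply, LinearMap.mulLeft_apply, LinearMap.mulRight_apply, sub_eq_zero]

/-! ## §3 The same splitting for `A_S = Ad S − 1 : X ↦ S X S⁻¹ − X` -/

/-- `A_S X = T_S (X S⁻¹)` for `S` invertible. [folklore] -/
theorem ad_sub_eq (S : Matrix n n K) (hS : IsUnit S.det) (X : Matrix n n K) :
    S * X * S⁻¹ - X = (LinearMap.mulLeft K S - LinearMap.mulRight K S) (X * S⁻¹) := by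
  rw [LinearMap.sub_apply, LinearMap.mulLeft_apply, LinearMap.mulRight_apply, Matrix.nonsing_inv_mul_cancel_right _ _ hS, mul_assoc]

/-- **`ker(Ad S − 1) = Z(S)`**: `SXS⁻¹ = X ↔ SX = XS`. [cite: Borel1991, §9.1] -/
theorem ad_sub_eq_zero_iff (S : Matrix n n K) (hS : IsUnit S.det) (X : Matrix n n K) :
    S * X * S⁻¹ - X = 0 ↔ S * X = X * S := by
  rw [sub_eq_zero]
  constructor
  · intro h
    have := congrArg (· * S) h
    simpa only [Matrix.nonsing_inv_mul_cancel_right _ _ hS] using this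
  · intro h
    rw [h, Matrix.mul_nonsing_inv_cancel_right _ _ hS]

/-- **`im(Ad S − 1) = [S, M_n(K)]`**: `{SXS⁻¹ − X} = {SX − XS}`. [cite: Borel1991, §9.1] -/
theorem range_ad_sub_eq (S : Matrix n n K) (hS : IsUnit S.det) :
    {Z : Matrix n n K | ∃ X, S * X * S⁻¹ - X = Z} = (LinearMap.range (LinearMap.mulLeft K S - LinearMap.mulRight K S) : Set (Matrix n n K)) := by
  ext Z
  simp only [Set.mem_setOf_eq, SetLike.mem_coe, LinearMap.mem_range]
  constructor
  · rintro ⟨X, rfl⟩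
    exact ⟨X * S⁻¹, (ad_sub_eq S hS X).symm⟩
  · rintro ⟨X, rfl⟩
    refine ⟨X * S, ?_⟩
    rw [ad_sub_eq S hS, Matrix.mul_nonsing_inv_cancel_right _ _ hS]

/-- **`M_n(K) = ker(Ad S − 1) ⊕ im(Ad S − 1)` for semisimple invertible `S`**, in elementwise form: every `Z` is `X₀ + (S X₁ S⁻¹ − X₁)` with `S X₀ = X₀ S`, and such an
`X₀` is unique. [cite: HarishChandra1999AdmissibleDistributions, §18 p. 79] [cite: Borel1991, §4.4, §9.1] -/
theorem exists_centralizer_add_ad_sub [PerfectField K] (S : Matrix n n K) (hS : Module.End.IsSemisimple (Matrix.toLin' S)) (hSu : IsUnit S.det) (Z : Matrix n n K) :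
    ∃ X₀ X₁ : Matrix n n K, S * X₀ = X₀ * S ∧ Z = X₀ + (S * X₁ * S⁻¹ - X₁) := by
  have hc := isCompl_centralizer_commutators S hS
  have hZ : Z ∈ LinearMap.ker (LinearMap.mulLeft K S - LinearMap.mulRight K S) ⊔ LinearMap.range (LinearMap.mulLeft K S - LinearMap.mulRight K S) := by
    rw [hc.sup_eq_top]; exact Submodule.mem_top
  obtain ⟨X₀, hX₀, R, hR, hsum⟩ := Submodule.mem_sup.1 hZ
  have hR' : R ∈ {Z : Matrix n n K | ∃ X, S * X * S⁻¹ - X = Z} := by rw [range_ad_sub_eq S hSu]; exact hR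
  obtain ⟨X₁, rfl⟩ := hR'
  exact ⟨X₀, X₁, (mem_ker_mulLeft_sub_mulRight_iff S X₀).1 hX₀, hsum.symm⟩

/-- Uniqueness of the centraliser component. [cite: Borel1991, §4.4] -/
theorem centralizer_component_unique [PerfectField K] (S : Matrix n n K) (hS : Module.End.IsSemisimple (Matrix.toLin' S)) (hSu : IsUnit S.det)
    {X₀ X₀' X₁ X₁' : Matrix n n K} (h₀ : S * X₀ = X₀ * S) (h₀' : S * X₀' = X₀' * S)
    (heq : X₀ + (S * X₁ * S⁻¹ - X₁) = X₀' + (S * X₁' * S⁻¹ - X₁')) : X₀ = X₀' := by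
  have hc := isCompl_centralizer_commutators S hS
  have hk : X₀ - X₀' ∈ LinearMap.ker (LinearMap.mulLeft K S - LinearMap.mulRight K S) := by
    rw [mem_ker_mulLeft_sub_mulRight_iff, mul_sub, sub_mul, h₀, h₀']
  have hr : X₀ - X₀' ∈ LinearMap.range (LinearMap.mulLeft K S - LinearMap.mulRight K S) := by
    have h1 : X₀ - X₀' = (S * X₁' * S⁻¹ - X₁') - (S * X₁ * S⁻¹ - X₁) := by
      rw [sub_eq_sub_iff_add_eq_add, heq, add_comm]
    rw [h1, ad_sub_eq S hSu, ad_sub_eq S hSu, ← map_sub]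
    exact LinearMap.mem_range_self _ _
  have hmem : X₀ - X₀' ∈ LinearMap.ker (LinearMap.mulLeft K S - LinearMap.mulRight K S) ⊓ LinearMap.range (LinearMap.mulLeft K S - LinearMap.mulRight K S) :=
    ⟨hk, hr⟩
  rw [hc.inf_eq_bot, Submodule.mem_bot] at hmem
  exact sub_eq_zero.1 hmem

/-! ## §4 Descent of the splitting to the fixed space of an involution commuting with `Ad S` (the Lie algebra `𝔲`) -/

/-- **`Fix τ = (Fix τ ∩ Z(S)) + (Ad S − 1)(Fix τ)`**: if `τ` is an additive involution of `M_n(K)` commuting with `X ↦ SXS⁻¹` and with the scalar `½` (`char K ≠ 2`),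
then every `τ`-fixed `Z` is `X₀ + (S X₁ S⁻¹ − X₁)` with `X₀, X₁` BOTH `τ`-fixed and `X₀ ∈ Z(S)` (uniqueness of the `Z(S)`-component forces `τX₀ = X₀`; replace `X₁` by
`½(X₁ + τX₁)`).  For `S ∈ U(σ, J)` and `τX = −J⁻¹(σX)ᵀJ` this reads `𝔲 = 𝔪_S ⊕ (Ad S − 1)𝔲` — the surjectivity of the differential of `(x, Y) ↦ x·s c(Y)·x⁻¹`.
[cite: HarishChandra1999AdmissibleDistributions, §18 p. 79] [cite: Borel1991, §9.1] -/
theorem exists_fixed_decomposition [PerfectField K] (S : Matrix n n K) (hS : Module.End.IsSemisimple (Matrix.toLin' S)) (hSu : IsUnit S.det)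
    (τ : Matrix n n K →+ Matrix n n K) (hτS : ∀ X, τ (S * X * S⁻¹) = S * τ X * S⁻¹) (hττ : ∀ X, τ (τ X) = X)
    (h2 : (2 : K) ≠ 0) (hτ2 : ∀ X, τ ((2 : K)⁻¹ • X) = (2 : K)⁻¹ • τ X)
    (Z : Matrix n n K) (hZ : τ Z = Z) :
    ∃ X₀ X₁ : Matrix n n K, τ X₀ = X₀ ∧ τ X₁ = X₁ ∧ S * X₀ = X₀ * S ∧ Z = X₀ + (S * X₁ * S⁻¹ - X₁) := by
  obtain ⟨X₀, X₁, h₀, hsum⟩ := exists_centralizer_add_ad_sub S hS hSu Z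
  -- apply `τ`: a second decomposition with centraliser component `τ X₀`
  have hτA : ∀ X, τ (S * X * S⁻¹ - X) = S * τ X * S⁻¹ - τ X := fun X => by rw [map_sub, hτS]
  have h₀τ : S * τ X₀ = τ X₀ * S := by
    -- `τX₀` commutes with `S`: `S (τX₀) S⁻¹ = τ(S X₀ S⁻¹) = τ X₀`
    have h1 : S * τ X₀ * S⁻¹ = τ X₀ := by rw [← hτS, h₀, Matrix.mul_nonsing_inv_cancel_right _ _ hSu]
    have := congrArg (· * S) h1
    simpa only [Matrix.nonsing_inv_mul_cancel_right _ _ hSu] using this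
  have hsum' : Z = τ X₀ + (S * τ X₁ * S⁻¹ - τ X₁) := by
    conv_lhs => rw [← hZ, hsum]
    rw [map_add, hτA]
  have hX₀ : τ X₀ = X₀ := (centralizer_component_unique S hS hSu h₀ h₀τ (hsum.symm.trans hsum')).symm
  -- average `X₁`
  refine ⟨X₀, (2 : K)⁻¹ • (X₁ + τ X₁), hX₀, ?_, h₀, ?_⟩
  · rw [hτ2, map_add, hττ, add_comm]
  · have hA1 : S * τ X₁ * S⁻¹ - τ X₁ = S * X₁ * S⁻¹ - X₁ := by
      have h := hsum.symm.trans hsum'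
      rw [hX₀] at h
      exact (add_left_cancel h).symm
    have hcalc : S * ((2 : K)⁻¹ • (X₁ + τ X₁)) * S⁻¹ - (2 : K)⁻¹ • (X₁ + τ X₁) =
        (2 : K)⁻¹ • ((S * X₁ * S⁻¹ - X₁) + (S * τ X₁ * S⁻¹ - τ X₁)) := by
      rw [Matrix.mul_smul, Matrix.smul_mul, ← smul_sub, mul_add, add_mul]
      congr 1
      abel
    rw [hcalc, hA1, ← two_smul K (S * X₁ * S⁻¹ - X₁), smul_smul, inv_mul_cancel₀ h2, one_smul]
    exact hsum

end MatrixOps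

end Summit.HodgeConjecture.HodgeConjecture.Cruxes.H413.K2E3AdSemisimpleKerRangeCompl
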